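import Summits.QuantumFields.BalabanUV.Beta.GAN24.CubicPushGaugeLegUnfolding

/-!
# `BalabanUV.Beta.GAN24.CubicPushGaugeLegUnfoldingFF` — binder row G-an2-4 ∕ (CONV-C), the (S) row ∕ (W-γ) one level up, the (ζ) step for the FIELD–FIELD sectors:
# **FOR A STENCIL FAMILY WITHOUT MULTIPLIER ROWS (the cubic member `e3OfK …` and the Lagrange member `SLam … hessFFAt` of `SrecAt j`), THE THREE-LEG UNFOLDING READS THE
# STENCILS AGAINST THE TWO RESPONSES `H_j n ⊗ cH_j·d(φ∘blk)`, SLOT COLUMN OUTSIDE:**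
# `Σ'_{(u,x)} Σ_κ Σ_κ₂ n κ u·dzφ κ₂ x·e3OfK Lc G_j S l t u x (inl κ)(inl κ₂) = cH_j·Σ_κ′ Σ'_{u′} colH G_j Lc l t κ′ u′·Σ'_{(y,w)} Σ_κ″ Σ_a (H_j n)(κ″,y)·dz(φ∘blk) a w·S κ′ u′ y w (inl κ″)(inl a)`
# (G-an2-4 CRUX TEAM (2), seat `b2b-balaban-gan24-formalise-leaf-02` = SUPPLIER side of leaf-06's (C2′)∕`hX` mechanism, gen 61; PART 3 — sequel of PART 1 `CubicPushGaugeLegUnfolding`)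

NOT IN PRINT; OUR BOOKKEEPING ([folklore] Fubini bookkeeping BY NAME over PART 1 `CubicPushGaugeLegUnfolding.hasSum_prod_gaugeLeg_e3OfK`, leaf-02∕an4's row antisymmetry
`CombKernelSheetResponse.coDressKBmAt_KInvStep_inr_inl_eq_neg_colH` (the coarse `inl`-rows of `G_j` are MINUS its `ℋ`-columns), road-P2 g41's vertex Fubini
`ChargeTowerStep.tsum_weighted_vertexOfK` and `KernelLegCharges.summable_prod_of_biLoc`; 0 `def`, 0 cited fact, 0 `def … : Prop`, 0 sorry).
HONEST FRAMING (cell contract, verbatim): «discharging `BetaPertH` makes Bałaban's UV stability UNCONDITIONAL — a real constructive-QFT result; it is NOT the continuum limit and NOT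
the Clay problem.»  HONEST DEPENDENCY (verbatim): «continuum YM on T⁴ ⇐ BetaPertH ∧ nine spine estimates (0/9 proved); BetaPertH ⇐ (D1) ∧ (D4) ∧ CAP+tail; G-an2-4 gates asym,
D1 and NE2/3/4.»

WHY.  PART 1 unfolds the two `G_j`-legs of the push `e3OfK Lc G_j S l t` against `n ⊗ dφ` into `−cH_j·Σ'_{(y,w)} Σ_f Σ_a ρL(f,y)·(vertexOfK G_j Lc S l t) y w f (inl a)·dz(φ∘blk) a w`
with the opaque `n`-leg `ρL(f, y) = Σ_κ Σ'_u n κ u·G_j (Lc•u) y (inr κ) f`.  Two of the three sectors of `SrecAt j` — the cubic member `e3OfK Lc G_{j−1} (SrecAt (j−1))` (an `mmRead`,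
field–field only) and the Lagrange member `SLam … (hessFFAt ρ)` (an1's constraint-Hessian table, field–field only) — have NO multiplier rows, so only `f = inl κ″` survives, where the
`n`-leg IS a response: `ρL(inl κ″, y) = −(H_j n)(κ″, y)`, `H_j n (κ″,y) = Σ_κ Σ'_u n κ u·colH G_j Lc κ u κ″ y` (row antisymmetry).  Unfolding the vertex (`Σ_κ′ Σ'_{u′} colH·S κ′ u′`,
road-P2's weighted vertex Fubini per `(κ″, a)`) puts the slot column OUTSIDE and the stencil's own two-leg pairing against `(H_j n, d(φ∘blk))` INSIDE — for the cubic member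
this inner pairing is the SAME functional one level down with data `(colH G_j Lc l t; H_j n, φ∘blk)` (the recursion of `X_{j+1}`), for the Lagrange member it is leaf-06 g49's
(ε-Λ) slot sum in (β)'s letters.  The border member (multiplier rows only) is PART 2 `BorderSectorSourcePairingSucc`.
* §1 `vertexOfK_inr_inl_eq_zero_of_ff` (no multiplier rows in the stencils ⇒ none in the vertex), `abs_fieldResponse_le'` (uniform bound of `H_j n`),
  `tsum_row_inl_eq_neg_fieldResponse` (the `inl`-rows of the `n`-leg are `−H_j n`).
* §2 **`hasSum_prod_gaugeLeg_e3OfK_ff`** — the statement in the title (every `j`, in-block root, any local stencil family with zero `(inr, inl)` blocks, bounded `n`, bounded `φ`).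
Asserts NO value of any resolvent column beyond the Ward laws quoted in PART 1; NOTHING of (C2′) ∕ (W-γ) at levels ≥ 1 ∕ (INV) ∕ (S) discharged; NEVER «G-an2-4 closed» as (CONV-C);
NOT D1, NOT `BetaPertH`, NOT continuum, NOT Clay.  2026-08-23; no existing file touched.
-/

noncomputable section

open Finset
open scoped BigOperators
open Literature.MathematicalPhysics.QuantumFieldTheory
open Literature.MathematicalPhysics.QuantumFieldTheory.Balaban1983to89
open Literature.MathematicalPhysics.QuantumFieldTheory.Balaban1983to89.Beta
open B12Sec2to5 (l1 l1_nonneg)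
open ExpKernelCalculus (Site MKer BiLoc Decays comp Zl Zl_nonneg summable_exp_shift' l1_sub_symm)
open OneStepResolventKernel (Fib LocStencil)
open AffineAveraging (Form0 Form1 box toSite unitVec dz)
open AveragingContours (blk)
open OneStepKernelFamily (KInvStep colH vertexOfK vertexFamily_vertexOfK decays_KInvStep)
open BalabanStepJets (locStencil_mono)
open Summit.QuantumFields.BalabanUV.Beta.AxialDressingRooted (coDressKBmAt decays_coDressKBmAt one_le_of_neZero)
open Summit.QuantumFields.BalabanUV.Beta.BorderedHessian (stepScale)
open Summit.QuantumFields.BalabanUV.Beta.SpineRooted (e3OfK)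
open Summit.QuantumFields.BalabanUV.Beta.GAN24.KernelLegCharges (summable_prod_of_biLoc)
open Summit.QuantumFields.BalabanUV.Beta.GAN24.ResolventLegCharges (tsum_exp_coarse_le')
open Summit.QuantumFields.BalabanUV.Beta.GAN24.CoarseGaugeSourceResponse (summable_bdd_mul)
open Summit.QuantumFields.BalabanUV.Beta.GAN24.ChargeTowerStep (tsum_weighted_vertexOfK)
open Summit.QuantumFields.BalabanUV.Beta.GAN24.CombKernelSheetResponse (coDressKBmAt_KInvStep_inr_inl_eq_neg_colH)
open Summit.QuantumFields.BalabanUV.Beta.GAN24.CubicPushGaugeLegUnfolding (summable_weight_col hasSum_prod_gaugeLeg_e3OfK)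

namespace Summit.QuantumFields.BalabanUV.Beta.GAN24.CubicPushGaugeLegUnfoldingFF

variable {d : ℕ}

/-! ## §1 Field–field stencils: no multiplier rows in the vertex; the `inl`-rows of the `n`-leg -/

/-- [folklore] If the stencils have no `(inr, inl)` block, neither has their vertex through any kernel. -/
theorem vertexOfK_inr_inl_eq_zero_of_ff (K : MKer (d + 1) (Fib d)) (N : ℕ) {S : Fin (d + 1) → Site (d + 1) → MKer (d + 1) (Fib d)}
    (hff : ∀ κ' u' y w m a, S κ' u' y w (Sum.inr m) (Sum.inl a) = 0) (l : Fin (d + 1)) (t y w : Site (d + 1)) (m a : Fin (d + 1)) :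
    vertexOfK K N S l t y w (Sum.inr m) (Sum.inl a) = 0 := by
  simp only [vertexOfK, OneStepResolventKernel.wsum, hff, mul_zero, tsum_zero, Finset.sum_const_zero]

section Step

variable {Lc : ℕ} [NeZero Lc] {r : Fin (d + 1) → ℕ}

/-- NOT IN PRINT; OUR BOOKKEEPING.  **THE `inl`-ROWS OF THE `n`-LEG ARE MINUS THE FIELD RESPONSE** (every `j`, any root, bounded `n`):
`Σ_κ Σ'_u n κ u·G_j (Lc•u) y (inr κ) (inl κ″) = −Σ_κ Σ'_u n κ u·colH G_j Lc κ u κ″ y` (leaf-02∕an4's row antisymmetry, termwise). -/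
theorem tsum_row_inl_eq_neg_fieldResponse (ρ : Fin (d + 1) → ℤ) (j : ℕ) (n : Form1 (d + 1) ℝ) (y : Site (d + 1)) (κ'' : Fin (d + 1)) :
    ∑ κ, ∑' u : Site (d + 1), n κ u * coDressKBmAt ρ Lc (KInvStep (d := d) Lc j) ((Lc : ℤ) • u) y (Sum.inr κ) (Sum.inl κ'')
      = -(∑ κ, ∑' u : Site (d + 1), n κ u * colH (coDressKBmAt ρ Lc (KInvStep (d := d) Lc j)) Lc κ u κ'' y) := by
  rw [← Finset.sum_neg_distrib]
  refine Finset.sum_congr rfl fun κ _ => ?_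
  rw [← tsum_neg]
  refine tsum_congr fun u => ?_
  rw [coDressKBmAt_KInvStep_inr_inl_eq_neg_colH, mul_neg]

/-- [folklore] **UNIFORM BOUND OF THE FIELD RESPONSE `H_j n`** (in-block root, bounded `n`): `|Σ_κ Σ'_u n κ u·colH G_j Lc κ u κ″ y| ≤ (d+1)·Bn·C_G·T` with the coarse-leg constant
`T = e^{δ_G·Lc·(d+1)}·Zl(δ_G)`. -/
theorem abs_fieldResponse_le' (hr : r ∈ box (d + 1) Lc) (j : ℕ) {n : Form1 (d + 1) ℝ} {Bn : ℝ} (hn : ∀ κ u, |n κ u| ≤ Bn) :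
    ∃ BH : ℝ, 0 ≤ BH ∧ ∀ (κ'' : Fin (d + 1)) (y : Site (d + 1)),
      |∑ κ, ∑' u : Site (d + 1), n κ u * colH (coDressKBmAt (toSite r) Lc (KInvStep (d := d) Lc j)) Lc κ u κ'' y| ≤ BH := by
  have hLc : 1 ≤ Lc := one_le_of_neZero Lc
  obtain ⟨δ, C, hδ, -, hK⟩ := decays_KInvStep (d := d) (Lc := Lc) j
  obtain ⟨δG, CG, hδG, hCG, hG⟩ := decays_coDressKBmAt hLc hr (K := KInvStep (d := d) Lc j) ⟨δ, C, hδ, hK.nonneg (Sum.inl 0), hK⟩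
  have hBn : 0 ≤ Bn := (abs_nonneg _).trans (hn 0 0)
  set T : ℝ := Real.exp (δG * ((Lc : ℝ) * (d + 1))) * Zl (d + 1) δG with hT
  refine ⟨((d + 1 : ℕ) : ℝ) * (Bn * CG * T), by
    have : 0 ≤ T := by rw [hT]; have := Zl_nonneg (D := d + 1) hδG; positivity
    positivity, fun κ'' y => ?_⟩
  refine (Finset.abs_sum_le_sum_abs _ _).trans ?_
  have hterm : ∀ κ, |∑' u : Site (d + 1), n κ u * colH (coDressKBmAt (toSite r) Lc (KInvStep (d := d) Lc j)) Lc κ u κ'' y| ≤ Bn * CG * T := by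
    intro κ
    have h := (summable_weight_col (N := Lc) hG hδG (ω := n κ) (fun u => hn κ u) y (Sum.inl κ'') (Sum.inr κ)).2
    have e : (fun z : Site (d + 1) => coDressKBmAt (toSite r) Lc (KInvStep (d := d) Lc j) y ((Lc : ℤ) • z) (Sum.inl κ'') (Sum.inr κ) * n κ z)
        = fun u => n κ u * colH (coDressKBmAt (toSite r) Lc (KInvStep (d := d) Lc j)) Lc κ u κ'' y := by
      funext u; rw [mul_comm]; rfl
    rw [e] at h
    exact h
  calc ∑ κ, |∑' u : Site (d + 1), n κ u * colH (coDressKBmAt (toSite r) Lc (KInvStep (d := d) Lc j)) Lc κ u κ'' y| ≤ ∑ _κ : Fin (d + 1), Bn * CG * T :=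
        Finset.sum_le_sum fun κ _ => hterm κ
    _ = _ := by simp only [Finset.sum_const, Finset.card_univ, Fintype.card_fin, nsmul_eq_mul]

/-! ## §2 The three-leg unfolding for field–field stencils, slot column outside -/

/-- NOT IN PRINT; OUR BOOKKEEPING.  **THE THREE-LEG UNFOLDING FOR FIELD–FIELD STENCIL FAMILIES** (every `j`, in-block root `ρ = toSite r`, any local stencil family `S` with zero
`(inr, inl)` blocks, bounded `n`, bounded coarse potential `φ`; `G_j = coDressKBmAt ρ Lc (KInvStep Lc j)`, `cH_j = (stepScale_j·Lc^{d+1})⁻¹`, `H_j n (κ″,y) = Σ_κ Σ'_u n κ u·colH G_j Lc κ u κ″ y`):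
`HasSum ((u,x) ↦ Σ_κ Σ_κ₂ n κ u·dzφ κ₂ x·e3OfK Lc G_j S l t u x (inl κ)(inl κ₂))
   (cH_j·Σ_κ′ Σ'_{u′} colH G_j Lc l t κ′ u′·Σ'_{(y,w)} Σ_κ″ Σ_a (H_j n)(κ″,y)·dz(φ∘blk Lc) a w·S κ′ u′ y w (inl κ″)(inl a))`
— the slot column outside, the stencil's own two-leg pairing against the two RESPONSES inside, in the product-`HasSum` currency of leaf-06 FILE A
(`CombFreeGaugeLegCharges.hasSum_prod_wilsonA_gaugeLeg ∕ hasSum_prod_hessFFAt_gaugeLeg`: read with `n := H_j n`, `ψ := φ ∘ blk Lc`, slot `(κ′, u′)`). -/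
theorem hasSum_prod_gaugeLeg_e3OfK_ff (hr : r ∈ box (d + 1) Lc) (j : ℕ)
    {S : Fin (d + 1) → Site (d + 1) → MKer (d + 1) (Fib d)} {Cs δs : ℝ} (hS : LocStencil S Cs δs) (hδs : 0 < δs)
    (hff : ∀ κ' u' y w m a, S κ' u' y w (Sum.inr m) (Sum.inl a) = 0)
    (l : Fin (d + 1)) (t : Site (d + 1)) {n : Form1 (d + 1) ℝ} {Bn : ℝ} (hn : ∀ κ u, |n κ u| ≤ Bn)
    {φ : Site (d + 1) → ℝ} {Bφ : ℝ} (hφ : ∀ y, |φ y| ≤ Bφ) :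
    HasSum (fun ux : Site (d + 1) × Site (d + 1) => ∑ κ, ∑ κ₂, n κ ux.1 * dz φ κ₂ ux.2 *
        e3OfK Lc (coDressKBmAt (toSite r) Lc (KInvStep (d := d) Lc j)) S l t ux.1 ux.2 (Sum.inl κ) (Sum.inl κ₂))
      ((stepScale d Lc j * (Lc : ℝ) ^ (d + 1))⁻¹ *
        ∑ κ', ∑' u' : Site (d + 1), colH (coDressKBmAt (toSite r) Lc (KInvStep (d := d) Lc j)) Lc l t κ' u' *
          ∑' yw : Site (d + 1) × Site (d + 1), ∑ κ'' : Fin (d + 1), ∑ a : Fin (d + 1),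
            (∑ κ, ∑' u : Site (d + 1), n κ u * colH (coDressKBmAt (toSite r) Lc (KInvStep (d := d) Lc j)) Lc κ u κ'' yw.1)
              * dz (fun x => φ (blk Lc x)) a yw.2 * S κ' u' yw.1 yw.2 (Sum.inl κ'') (Sum.inl a)) := by
  classical
  have hLc : 1 ≤ Lc := one_le_of_neZero Lc
  set G : MKer (d + 1) (Fib d) := coDressKBmAt (toSite r) Lc (KInvStep (d := d) Lc j) with hGdef
  set cH : ℝ := (stepScale d Lc j * (Lc : ℝ) ^ (d + 1))⁻¹ with hcH
  obtain ⟨δ, C, hδ, -, hK⟩ := decays_KInvStep (d := d) (Lc := Lc) j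
  obtain ⟨δG, CG, hδG, hCG, hG⟩ := decays_coDressKBmAt hLc hr (K := KInvStep (d := d) Lc j) ⟨δ, C, hδ, hK.nonneg (Sum.inl 0), hK⟩
  have hCs : 0 ≤ Cs := (hS 0 0).nonneg (Sum.inl 0)
  set m : ℝ := min δs δG with hm
  have hm0 : 0 < m := lt_min hδs hδG
  have hSm : LocStencil S Cs m := locStencil_mono hS hCs (min_le_left _ _)
  set V : MKer (d + 1) (Fib d) := vertexOfK G Lc S l t with hVdef
  have hV : BiLoc V ((Lc : ℤ) • t) ((Lc : ℤ) • t) _ (m / 2) := vertexFamily_vertexOfK (N := Lc) hG hCG hSm hm0 (min_le_right _ _) l t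
  have hBφ : 0 ≤ Bφ := (abs_nonneg _).trans (hφ 0)
  have hgb : ∀ a w, |dz (fun x => φ (blk Lc x)) a w| ≤ 2 * Bφ := KKTFluctuationEnergy.abs_dz_le (fun x => hφ (blk Lc x))
  -- PART 1
  have h1 := hasSum_prod_gaugeLeg_e3OfK hr j hS hδs l t hn hφ
  -- the field response and its bound
  set Hn : Fin (d + 1) → Site (d + 1) → ℝ := fun κ'' y => ∑ κ, ∑' u : Site (d + 1), n κ u * colH G Lc κ u κ'' y with hHn
  obtain ⟨BH, hBH0, hHb⟩ := abs_fieldResponse_le' (d := d) hr j hn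
  -- pointwise: only the `inl` rows survive, and they are `−Hn`
  set Φ : Site (d + 1) × Site (d + 1) → ℝ := fun yw => ∑ f : Fib d, ∑ a : Fin (d + 1),
    (∑ κ, ∑' u : Site (d + 1), n κ u * G ((Lc : ℤ) • u) yw.1 (Sum.inr κ) f) * V yw.1 yw.2 f (Sum.inl a) * dz (fun x => φ (blk Lc x)) a yw.2 with hΦ
  have hΦeq : ∀ yw : Site (d + 1) × Site (d + 1), Φ yw
      = -(∑ κ'' : Fin (d + 1), ∑ a : Fin (d + 1), Hn κ'' yw.1 * V yw.1 yw.2 (Sum.inl κ'') (Sum.inl a) * dz (fun x => φ (blk Lc x)) a yw.2) := by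
    intro yw
    simp only [hΦ]
    rw [Fintype.sum_sum_type]
    have h0 : ∀ m a, V yw.1 yw.2 (Sum.inr m) (Sum.inl a) = 0 := fun m a => vertexOfK_inr_inl_eq_zero_of_ff G Lc hff l t yw.1 yw.2 m a
    simp only [h0, mul_zero, zero_mul, Finset.sum_const_zero, add_zero]
    rw [← Finset.sum_neg_distrib]
    refine Finset.sum_congr rfl fun κ'' _ => ?_
    rw [← Finset.sum_neg_distrib]
    refine Finset.sum_congr rfl fun a _ => ?_
    rw [hGdef, tsum_row_inl_eq_neg_fieldResponse (toSite r) j n yw.1 κ'']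
    simp only [hHn]
    ring
  -- summability of each `(κ″, a)` family
  have hs : ∀ κ'' a, Summable fun yw : Site (d + 1) × Site (d + 1) => Hn κ'' yw.1 * V yw.1 yw.2 (Sum.inl κ'') (Sum.inl a) * dz (fun x => φ (blk Lc x)) a yw.2 := by
    intro κ'' a
    have hw : ∀ yw : Site (d + 1) × Site (d + 1), |Hn κ'' yw.1 * dz (fun x => φ (blk Lc x)) a yw.2| ≤ BH * (2 * Bφ) := fun yw => by
      rw [abs_mul]; exact mul_le_mul (hHb κ'' yw.1) (hgb a yw.2) (abs_nonneg _) hBH0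
    exact (summable_bdd_mul (summable_prod_of_biLoc hV (half_pos hm0) (Sum.inl κ'') (Sum.inl a)) hw).congr fun yw => by ring
  -- the value
  have hval : (∑' yw : Site (d + 1) × Site (d + 1), Φ yw)
      = -(∑ κ'' : Fin (d + 1), ∑ a : Fin (d + 1), ∑ κ', ∑' u' : Site (d + 1), colH G Lc l t κ' u' *
          ∑' yw : Site (d + 1) × Site (d + 1), Hn κ'' yw.1 * dz (fun x => φ (blk Lc x)) a yw.2 * S κ' u' yw.1 yw.2 (Sum.inl κ'') (Sum.inl a)) := by
    rw [tsum_congr hΦeq, tsum_neg, Summable.tsum_finsetSum (fun κ'' _ => summable_sum fun a _ => hs κ'' a)]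
    congr 1
    refine Finset.sum_congr rfl fun κ'' _ => ?_
    rw [Summable.tsum_finsetSum (fun a _ => hs κ'' a)]
    refine Finset.sum_congr rfl fun a _ => ?_
    rw [hVdef]
    exact tsum_weighted_vertexOfK (N := Lc) hLc hG hδG hS hδs l t (Hn κ'') (fun w => dz (fun x => φ (blk Lc x)) a w) (hHb κ'') (hgb a)
      (Sum.inl κ'') (Sum.inl a)
  -- move the finite `(κ″, a)` sums inside: per stencil bond the pair family is summable (the stencil is bi-localised), and the slot column is summable
  have hS2 : ∀ (κ' : Fin (d + 1)) (u' : Site (d + 1)) (κ'' a : Fin (d + 1)), Summable fun yw : Site (d + 1) × Site (d + 1) =>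
      Hn κ'' yw.1 * dz (fun x => φ (blk Lc x)) a yw.2 * S κ' u' yw.1 yw.2 (Sum.inl κ'') (Sum.inl a) := by
    intro κ' u' κ'' a
    have hw : ∀ yw : Site (d + 1) × Site (d + 1), |Hn κ'' yw.1 * dz (fun x => φ (blk Lc x)) a yw.2| ≤ BH * (2 * Bφ) := fun yw => by
      rw [abs_mul]; exact mul_le_mul (hHb κ'' yw.1) (hgb a yw.2) (abs_nonneg _) hBH0
    exact summable_bdd_mul (summable_prod_of_biLoc (hS κ' u') hδs (Sum.inl κ'') (Sum.inl a)) hw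
  -- uniform bound of the inner pair sums, hence summability of the slot column against them
  have hinner : ∀ (κ'' a κ' : Fin (d + 1)) (u' : Site (d + 1)),
      |∑' yw : Site (d + 1) × Site (d + 1), Hn κ'' yw.1 * dz (fun x => φ (blk Lc x)) a yw.2 * S κ' u' yw.1 yw.2 (Sum.inl κ'') (Sum.inl a)|
        ≤ BH * (2 * Bφ) * (Cs * (Zl (d + 1) δs * Zl (d + 1) δs)) := by
    intro κ'' a κ' u'
    have hs0 := hS2 κ' u' κ'' a
    have hmaj : HasSum (fun yw : Site (d + 1) × Site (d + 1) => BH * (2 * Bφ) * (Cs * (Real.exp (-δs * l1 (yw.1 - u')) * Real.exp (-δs * l1 (yw.2 - u')))))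
        (BH * (2 * Bφ) * (Cs * (Zl (d + 1) δs * Zl (d + 1) δs))) := by
      have h1 := summable_exp_shift' (D := d + 1) hδs u'
      have h12 := h1.hasSum.mul h1.hasSum (h1.mul_of_nonneg h1 (fun _ => (Real.exp_pos _).le) (fun _ => (Real.exp_pos _).le))
      simp only [ExpKernelCalculus.tsum_exp_shift'] at h12
      exact (h12.mul_left Cs).mul_left _
    have hle : ∀ yw : Site (d + 1) × Site (d + 1), |Hn κ'' yw.1 * dz (fun x => φ (blk Lc x)) a yw.2 * S κ' u' yw.1 yw.2 (Sum.inl κ'') (Sum.inl a)|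
        ≤ BH * (2 * Bφ) * (Cs * (Real.exp (-δs * l1 (yw.1 - u')) * Real.exp (-δs * l1 (yw.2 - u')))) := by
      intro yw
      rw [abs_mul, abs_mul]
      have e3 : |S κ' u' yw.1 yw.2 (Sum.inl κ'') (Sum.inl a)| ≤ Cs * (Real.exp (-δs * l1 (yw.1 - u')) * Real.exp (-δs * l1 (yw.2 - u'))) := by
        have := hS κ' u' yw.1 yw.2 (Sum.inl κ'') (Sum.inl a)
        rwa [mul_add, Real.exp_add] at this
      exact mul_le_mul (mul_le_mul (hHb κ'' yw.1) (hgb a yw.2) (abs_nonneg _) hBH0) e3 (abs_nonneg _) (by positivity)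
    calc |∑' yw : Site (d + 1) × Site (d + 1), Hn κ'' yw.1 * dz (fun x => φ (blk Lc x)) a yw.2 * S κ' u' yw.1 yw.2 (Sum.inl κ'') (Sum.inl a)|
        ≤ ∑' yw : Site (d + 1) × Site (d + 1), |Hn κ'' yw.1 * dz (fun x => φ (blk Lc x)) a yw.2 * S κ' u' yw.1 yw.2 (Sum.inl κ'') (Sum.inl a)| := by
          have h := norm_tsum_le_tsum_norm hs0.norm
          simpa only [Real.norm_eq_abs] using h
      _ ≤ _ := hs0.abs.tsum_le_tsum hle hmaj.summable
      _ = _ := hmaj.tsum_eq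
  have hcol : ∀ (κ'' a κ' : Fin (d + 1)), Summable fun u' : Site (d + 1) => colH G Lc l t κ' u' *
      ∑' yw : Site (d + 1) × Site (d + 1), Hn κ'' yw.1 * dz (fun x => φ (blk Lc x)) a yw.2 * S κ' u' yw.1 yw.2 (Sum.inl κ'') (Sum.inl a) := by
    intro κ'' a κ'
    have hc : Summable fun u' : Site (d + 1) => colH G Lc l t κ' u' := by
      refine Summable.of_norm_bounded ((summable_exp_shift' hδG ((Lc : ℤ) • t)).mul_left CG) (fun u' => ?_)
      rw [Real.norm_eq_abs]
      exact hG _ _ _ _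
    exact (summable_bdd_mul hc (fun u' => hinner κ'' a κ' u')).congr fun u' => by ring
  have hx : (∑ κ'' : Fin (d + 1), ∑ a : Fin (d + 1), ∑ κ', ∑' u' : Site (d + 1), colH G Lc l t κ' u' *
        ∑' yw : Site (d + 1) × Site (d + 1), Hn κ'' yw.1 * dz (fun x => φ (blk Lc x)) a yw.2 * S κ' u' yw.1 yw.2 (Sum.inl κ'') (Sum.inl a))
      = ∑ κ', ∑' u' : Site (d + 1), colH G Lc l t κ' u' *
        ∑' yw : Site (d + 1) × Site (d + 1), ∑ κ'' : Fin (d + 1), ∑ a : Fin (d + 1),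
          Hn κ'' yw.1 * dz (fun x => φ (blk Lc x)) a yw.2 * S κ' u' yw.1 yw.2 (Sum.inl κ'') (Sum.inl a) := by
    -- reorder the finite sums `(κ″, a, κ′) → (κ′, κ″, a)` and merge them into the two series
    have s1 : ∀ A : Fin (d + 1) → Fin (d + 1) → Fin (d + 1) → ℝ,
        (∑ κ'' : Fin (d + 1), ∑ a : Fin (d + 1), ∑ κ' : Fin (d + 1), A κ'' a κ') = ∑ κ' : Fin (d + 1), ∑ κ'' : Fin (d + 1), ∑ a : Fin (d + 1), A κ'' a κ' :=
      fun A => by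
        calc (∑ κ'' : Fin (d + 1), ∑ a : Fin (d + 1), ∑ κ' : Fin (d + 1), A κ'' a κ')
            = ∑ κ'' : Fin (d + 1), ∑ κ' : Fin (d + 1), ∑ a : Fin (d + 1), A κ'' a κ' := Finset.sum_congr rfl fun κ'' _ => Finset.sum_comm
          _ = ∑ κ' : Fin (d + 1), ∑ κ'' : Fin (d + 1), ∑ a : Fin (d + 1), A κ'' a κ' := Finset.sum_comm
    rw [s1 (fun κ'' a κ' => ∑' u' : Site (d + 1), colH G Lc l t κ' u' *
          ∑' yw : Site (d + 1) × Site (d + 1), Hn κ'' yw.1 * dz (fun x => φ (blk Lc x)) a yw.2 * S κ' u' yw.1 yw.2 (Sum.inl κ'') (Sum.inl a))]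
    refine Finset.sum_congr rfl fun κ' _ => ?_
    have e1 : ∀ κ'' : Fin (d + 1), (∑ a : Fin (d + 1), ∑' u' : Site (d + 1), colH G Lc l t κ' u' *
          ∑' yw : Site (d + 1) × Site (d + 1), Hn κ'' yw.1 * dz (fun x => φ (blk Lc x)) a yw.2 * S κ' u' yw.1 yw.2 (Sum.inl κ'') (Sum.inl a))
        = ∑' u' : Site (d + 1), ∑ a : Fin (d + 1), colH G Lc l t κ' u' *
          ∑' yw : Site (d + 1) × Site (d + 1), Hn κ'' yw.1 * dz (fun x => φ (blk Lc x)) a yw.2 * S κ' u' yw.1 yw.2 (Sum.inl κ'') (Sum.inl a) :=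
      fun κ'' => (Summable.tsum_finsetSum (fun a _ => hcol κ'' a κ')).symm
    rw [Finset.sum_congr rfl (fun κ'' _ => e1 κ''), ← Summable.tsum_finsetSum (fun κ'' _ => summable_sum fun a _ => hcol κ'' a κ')]
    refine tsum_congr fun u' => ?_
    have e2 : (∑' yw : Site (d + 1) × Site (d + 1), ∑ κ'' : Fin (d + 1), ∑ a : Fin (d + 1),
          Hn κ'' yw.1 * dz (fun x => φ (blk Lc x)) a yw.2 * S κ' u' yw.1 yw.2 (Sum.inl κ'') (Sum.inl a))
        = ∑ κ'' : Fin (d + 1), ∑ a : Fin (d + 1), ∑' yw : Site (d + 1) × Site (d + 1),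
          Hn κ'' yw.1 * dz (fun x => φ (blk Lc x)) a yw.2 * S κ' u' yw.1 yw.2 (Sum.inl κ'') (Sum.inl a) := by
      rw [Summable.tsum_finsetSum (fun κ'' _ => summable_sum fun a _ => hS2 κ' u' κ'' a)]
      exact Finset.sum_congr rfl fun κ'' _ => Summable.tsum_finsetSum (fun a _ => hS2 κ' u' κ'' a)
    rw [e2, Finset.mul_sum]
    refine Finset.sum_congr rfl fun κ'' _ => ?_
    rw [Finset.mul_sum]
  have h2 : HasSum (fun ux : Site (d + 1) × Site (d + 1) => ∑ κ, ∑ κ₂, n κ ux.1 * dz φ κ₂ ux.2 * e3OfK Lc G S l t ux.1 ux.2 (Sum.inl κ) (Sum.inl κ₂))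
      (-(cH * ∑' yw, Φ yw)) := by
    simpa only [hΦ] using h1
  rw [hval, hx] at h2
  simpa only [mul_neg, neg_neg, hHn] using h2

end Step

end Summit.QuantumFields.BalabanUV.Beta.GAN24.CubicPushGaugeLegUnfoldingFF

end
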